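import Summits.NavierStokesRegularity.NavierStokesRegularity.Theorems.TerminalTraceTypeITraceScarL3CaseOneFamily
import Summits.NavierStokesRegularity.NavierStokesRegularity.Theorems.TerminalTraceTypeITraceScarL3CaseOneLimit
import HarnessLib

/-!
# CASE-1 ZOOM PACKAGE (stub Z4 `stub_caseOneZoom` of the line `radius_dichotomy`, item `TerminalTrace.TypeITraceScarL3`,
# stmt-NavierStokesRegularity-18385)

Seat nsreg-C26-p1 g5 (cell ns-regularity-ideate), `--supports stmt-NavierStokesRegularity-18385`; memo
`HOME/nsreg-C26-p1-LOUD-ZOOM-18385.md` §2/§4 Z4, skeleton `Cruxes/TypeITraceScarL3/Lines/radius_dichotomy_CANDIDATE.lean` (v5.3).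

`caseOneZoom`: from the CASE-1 data of the regularity-radius dichotomy an extinct Type-I apex of class `(M, D₀, C)`
produces an extinct Type-I apex of SOME class `(M', D₀', C')` which is a.e. bounded by `4` on the late whole-space slab
`]−1/16, 0[ × ℝ³` and is NOT a.e. zero on `Q_3(0)`.  Proof: the zoom family at the varying regular centres
(`caseOne_family`), its subsequential limit with all the class properties, the late bound and the non-triviality
(`caseOne_limit`), and a representative obeying the rate at EVERY negative time (`exists_repr_hasTypeITimeDecay`), to
which every a.e. statement transfers.
WHAT THIS IS NOT: 18385 / NS regularity NOT proved (the composition of the line does that BY NAME once all stubs are in).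
[cite: EscauriazaSereginSverak2003, §3; Seregin2014, §6.6 Prop. 6.20]
-/

noncomputable section

set_option linter.dupNamespace false

namespace Summit.NavierStokesRegularity.NavierStokesRegularity.Theorems.TypeITraceScarL3

open MeasureTheory Set Function Filter Topology TopologicalSpace Metric InnerProductSpace
open Literature.Analysis.FluidPDE
open scoped NNReal ENNReal RealInnerProductSpace

set_option maxHeartbeats 3200000 in
/-- **Stub Z4 «CASE-1 ZOOM PACKAGE»** (`stub_caseOneZoom` of `Lines/radius_dichotomy_CANDIDATE.lean` v5.1/v5.3, statement
VERBATIM): see the module docstring. [cite: EscauriazaSereginSverak2003, §3] [cite: Seregin2014, §6.6 Prop. 6.20] -/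
theorem caseOneZoom :
    ∀ (U : ℝ → EuclideanSpace ℝ (Fin 3) → EuclideanSpace ℝ (Fin 3))
      (P : ℝ → EuclideanSpace ℝ (Fin 3) → ℝ)
      (G : ℝ → EuclideanSpace ℝ (Fin 3) →
        EuclideanSpace ℝ (Fin 3) →L[ℝ] EuclideanSpace ℝ (Fin 3))
      (M D₀ : ℝ≥0) (C : ℝ),
      (∀ a : ℝ, 0 < a →
        IsSuitableWeakSolutionInBall a (0 : ℝ × EuclideanSpace ℝ (Fin 3)) U P) →
      (∀ a : ℝ, 0 < a →
        HasWeakSpatialGradientOn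
          (parabolicCylinderOpens a (0 : ℝ × EuclideanSpace ℝ (Fin 3))) U G) →
      (∀ a : ℝ, 0 < a →
        typeIBound (parabolicCylinder a (0 : ℝ × EuclideanSpace ℝ (Fin 3))) U P G ≤ M) →
      (∀ z₀ : ℝ × EuclideanSpace ℝ (Fin 3), z₀.1 ≤ 0 →
        ∀ r : ℝ, 0 < r → cknD r z₀ P ≤ D₀) →
      (∀ s : ℝ, s < 0 →
        ∀ᵐ y : EuclideanSpace ℝ (Fin 3), ‖U s y‖ ≤ C / Real.sqrt (-s)) →
      (∀ φ : EuclideanSpace ℝ (Fin 3) → EuclideanSpace ℝ (Fin 3),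
        ContDiff ℝ (⊤ : ℕ∞) φ →
        HasCompactSupport φ → ∀ ε : ℝ, 0 < ε →
        ∃ s₀ : ℝ, s₀ < 0 ∧ ∀ᵐ s ∂(volume.restrict (Ioo s₀ 0)), |∫ y, ⟪U s y, φ y⟫| ≤ ε) →
      (∀ A : ℝ, 0 < A → ∃ (yc : EuclideanSpace ℝ (Fin 3)) (r : ℝ), 0 < r ∧ r ≤ 1 / 2 ∧
        (∀ y' ∈ ball yc (A * r),
          ∀ᵐ z ∂(volume.restrict (parabolicCylinder (r / 4) (((0 : ℝ), y') : ℝ × EuclideanSpace ℝ (Fin 3)))),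
            ‖U z.1 z.2‖ ≤ (r / 4)⁻¹) ∧
        ¬ (∀ᵐ z ∂(volume.restrict (parabolicCylinder (2 * r) (((0 : ℝ), yc) : ℝ × EuclideanSpace ℝ (Fin 3)))),
            ‖U z.1 z.2‖ ≤ (2 * r)⁻¹)) →
      ∃ (M' D₀' : ℝ≥0) (C' : ℝ) (V : ℝ → EuclideanSpace ℝ (Fin 3) → EuclideanSpace ℝ (Fin 3))
        (Q : ℝ → EuclideanSpace ℝ (Fin 3) → ℝ)
        (H : ℝ → EuclideanSpace ℝ (Fin 3) →
          EuclideanSpace ℝ (Fin 3) →L[ℝ] EuclideanSpace ℝ (Fin 3)),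
      (∀ a : ℝ, 0 < a →
        IsSuitableWeakSolutionInBall a (0 : ℝ × EuclideanSpace ℝ (Fin 3)) V Q) ∧
      (∀ a : ℝ, 0 < a →
        HasWeakSpatialGradientOn
          (parabolicCylinderOpens a (0 : ℝ × EuclideanSpace ℝ (Fin 3))) V H) ∧
      (∀ a : ℝ, 0 < a →
        typeIBound (parabolicCylinder a (0 : ℝ × EuclideanSpace ℝ (Fin 3))) V Q H ≤ M') ∧
      (∀ z₀ : ℝ × EuclideanSpace ℝ (Fin 3), z₀.1 ≤ 0 →
        ∀ r : ℝ, 0 < r → cknD r z₀ Q ≤ D₀') ∧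
      (∀ s : ℝ, s < 0 →
        ∀ᵐ y : EuclideanSpace ℝ (Fin 3), ‖V s y‖ ≤ C' / Real.sqrt (-s)) ∧
      (∀ φ : EuclideanSpace ℝ (Fin 3) → EuclideanSpace ℝ (Fin 3),
        ContDiff ℝ (⊤ : ℕ∞) φ →
        HasCompactSupport φ → ∀ ε : ℝ, 0 < ε →
        ∃ s₀ : ℝ, s₀ < 0 ∧ ∀ᵐ s ∂(volume.restrict (Ioo s₀ 0)), |∫ y, ⟪V s y, φ y⟫| ≤ ε) ∧
      (∀ᵐ z ∂(volume.restrict (Ioo (-(1 / 16 : ℝ)) 0 ×ˢ (univ : Set (EuclideanSpace ℝ (Fin 3))))),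
          ‖V z.1 z.2‖ ≤ 4) ∧
      ¬ (∀ᵐ z ∂(volume.restrict (parabolicCylinder 3 (0 : ℝ × EuclideanSpace ℝ (Fin 3)))), V z.1 z.2 = 0) := by
  intro U P G M D₀ C hsw hG hI hD hrate htop hcase
  -- ### `C ≥ 0` (otherwise the rate at `s = -1` is absurd)
  have hC : 0 ≤ C := by
    by_contra hC
    simp only [not_le] at hC
    have h := hrate (-1) (by norm_num)
    rw [neg_neg, Real.sqrt_one, div_one] at h
    have hfalse : ∀ᵐ y : EuclideanSpace ℝ (Fin 3), False := by
      filter_upwards [h] with y hy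
      linarith [norm_nonneg (U (-1) y)]
    rw [ae_iff] at hfalse
    simp only [not_false_eq_true, setOf_true] at hfalse
    exact NeZero.ne (volume : Measure (EuclideanSpace ℝ (Fin 3))) (Measure.measure_univ_eq_zero.mp hfalse)
  -- ### the family, its limit
  obtain ⟨F, Pk, Gk, hFsw, hFG, hFI, hFD, hFrate, hFtop, hlate, hnot⟩ :=
    caseOne_family hsw hG hI hD hrate htop hcase
  obtain ⟨w, ϖ, H, hwsw, hH, h4I, hDlim, hae_rate, htop_w, hlate_w, hne⟩ :=
    caseOne_limit hC hFsw hFG hFI hFD hFrate hFtop hlate hnot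
  -- ### a representative obeying the rate at every negative time
  obtain ⟨w', haew, hdec'⟩ := exists_repr_hasTypeITimeDecay hC hae_rate
  have hQslab : ∀ a : ℝ, parabolicCylinder a (0 : ℝ × EuclideanSpace ℝ (Fin 3)) ⊆
      Iio (0 : ℝ) ×ˢ (univ : Set (EuclideanSpace ℝ (Fin 3))) := fun a => parabolicCylinder_origin_subset_slab a
  have hQle : ∀ a : ℝ, parabolicCylinderOpens a (0 : ℝ × EuclideanSpace ℝ (Fin 3)) ≤
      slab (EuclideanSpace ℝ (Fin 3)) (Iio 0) isOpen_Iio := by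
    intro a z hz
    show z ∈ ((slab (EuclideanSpace ℝ (Fin 3)) (Iio 0) isOpen_Iio : Opens (ℝ × EuclideanSpace ℝ (Fin 3))) :
      Set (ℝ × EuclideanSpace ℝ (Fin 3)))
    rw [coe_slab]
    exact hQslab a hz
  have haew' : ∀ᵐ z ∂(volume.restrict ((slab (EuclideanSpace ℝ (Fin 3)) (Iio 0) isOpen_Iio :
      Opens (ℝ × EuclideanSpace ℝ (Fin 3))) : Set (ℝ × EuclideanSpace ℝ (Fin 3)))), uncurry w z = uncurry w' z := by
    rw [coe_slab]
    exact haew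
  have haew_a : ∀ a : ℝ, ∀ᵐ z ∂(volume.restrict (parabolicCylinder a (0 : ℝ × EuclideanSpace ℝ (Fin 3)))),
      uncurry w z = uncurry w' z := fun a => ae_restrict_of_ae_restrict_of_subset (hQslab a) haew
  have hslice : ∀ᵐ s ∂(volume.restrict (Iio (0 : ℝ))), ∀ᵐ y : EuclideanSpace ℝ (Fin 3), w s y = w' s y := by
    have h1 : ∀ᵐ z ∂((volume.restrict (Iio (0 : ℝ))).prod (volume : Measure (EuclideanSpace ℝ (Fin 3)))),
        uncurry w z = uncurry w' z := by
      rw [← Measure.restrict_univ (μ := (volume : Measure (EuclideanSpace ℝ (Fin 3)))),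
        Measure.prod_restrict, ← Measure.volume_eq_prod]
      exact haew
    exact Measure.ae_ae_of_ae_prod h1
  -- the local Type-I bound of the representative
  have hIw' : typeIBound (Iio (0 : ℝ) ×ˢ univ) w' ϖ H < ⊤ := by
    rw [← typeIBound_congr_ae haew]
    exact lt_of_le_of_lt h4I (ENNReal.mul_lt_top (by simp) ENNReal.coe_lt_top)
  set M' : ℝ≥0 := (typeIBound (Iio (0 : ℝ) ×ˢ univ) w' ϖ H).toNNReal with hM'
  have hM'eq : ((M' : ℝ≥0) : ℝ≥0∞) = typeIBound (Iio (0 : ℝ) ×ˢ univ) w' ϖ H := ENNReal.coe_toNNReal hIw'.ne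
  refine ⟨M', D₀, C, w', ϖ, H, ?_, ?_, ?_, hDlim, ?_, ?_, ?_, ?_⟩
  · intro a ha
    exact (hwsw a ha).congr_ae' (haew_a a) (ae_of_all _ fun _ => rfl)
  · intro a _
    exact (hH.congr_ae haew').mono (hQle a)
  · intro a _
    rw [hM'eq]
    exact typeIBound_mono (hQslab a)
  · intro s hs
    exact ae_of_all _ fun y => hdec' s hs y
  · intro φ hφ hφc ε hε
    obtain ⟨s₀, hs₀, hws⟩ := htop_w φ hφ hφc ε hε
    refine ⟨s₀, hs₀, ?_⟩
    have hsl_r : ∀ᵐ s ∂(volume.restrict (Ioo s₀ 0)),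
        ∀ᵐ y : EuclideanSpace ℝ (Fin 3), w s y = w' s y :=
      ae_restrict_of_ae_restrict_of_subset Ioo_subset_Iio_self hslice
    filter_upwards [hws, hsl_r] with s hs hsl
    have e : ∫ y, ⟪w' s y, φ y⟫ = ∫ y, ⟪w s y, φ y⟫ :=
      integral_congr_ae (hsl.mono fun y hy => by simp only [hy])
    rw [e]
    exact hs
  · have hsub : Ioo (-(1 / 16 : ℝ)) 0 ×ˢ (univ : Set (EuclideanSpace ℝ (Fin 3))) ⊆
        Iio (0 : ℝ) ×ˢ (univ : Set (EuclideanSpace ℝ (Fin 3))) := prod_mono Ioo_subset_Iio_self Subset.rfl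
    filter_upwards [hlate_w, ae_restrict_of_ae_restrict_of_subset hsub haew] with z hz hzw
    have e : w' z.1 z.2 = w z.1 z.2 := by
      have : uncurry w z = uncurry w' z := hzw
      simp only [uncurry] at this
      rw [this]
    rw [e]
    exact hz
  · intro hzero
    apply hne
    filter_upwards [hzero, haew_a 3] with z hz hzw
    have : uncurry w z = uncurry w' z := hzw
    simp only [uncurry] at this
    rw [this]
    exact hz

end Summit.NavierStokesRegularity.NavierStokesRegularity.Theorems.TypeITraceScarL3

end
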